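import Literature.NumberTheory.Transcendental.KaehlerHodgeLaplacianProofs

/-!
# `dolbeaultLaplacian_eq_delLaplacian`: corrected statement (holomorphic atlas as a binder)

`Literature/NumberTheory/Transcendental/KaehlerHodge.lean` renders the Kähler identity
`Δ_∂̄ = Δ_∂` (Voisin (2002), §6.1.2, Thm. 6.7; Huybrechts (2005), Prop. 3.1.12 (iii);
Griffiths–Harris (1978), p. 115) as the named fact
`Literature.NumberTheory.Transcendental.dolbeaultLaplacian_eq_delLaplacian g o`. That
`def … : Prop` was written after a section `variable … [IsManifold 𝓘(ℂ, E) ω M] …`, but a `def`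
abstracts only the section variables its body *uses*, and nothing in the body uses the complex
structure instance (the metric `g` is typed over the real `C^∞` tangent bundle only). Its
elaborated binders are therefore `E, M` (normed-space / charted-space instances), `k m`,
`[FiniteDimensional ℂ E]`, `n`, `[Fact (finrank ℝ E = n)]`, `[IsManifold 𝓘(ℝ, E) ∞ M]`, `g`, `o`
(checked with `#check`; the same accident as for its siblings
`cHodgeLaplacian_eq_two_smul_dolbeaultLaplacian` — see the *Correction* in `KaehlerHodge.lean` —
and `finite_dolbeaultHarmonicForms` — `KaehlerHodgeComplexAtlasFact.lean` —, and as for the former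
`isSmoothForm_kaehlerForm` of `Literature/Geometry/Kaehler/Kaehler.lean`). As a `Prop` family the
fact thus ranges over **every real `C^∞` atlas** on `M` with values in the complex vector space
`E`, the "complex structure" `J = i • id` of `TangentSpace 𝓘(ℝ, E) x = E` being read in the
preferred chart at `x`; the sources state it for *complex* (Kähler) manifolds.

**In that generality the statement is false** (informal refutation, not formalised here). Take
`M = ℂ` with the real-smooth two-chart atlas `{id, conj}`, `chartAt z = id` for `0 ≤ im z` and
`conj` for `im z < 0`, the flat metric (smooth, `±i`-invariant, and Kähler in the sense of
`IsKaehler` since `3`-forms vanish on a surface), the orientation family making the volume form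
smooth, and the smooth real `1`-form `α = y² dy` (`y = im z`; `k = m = 1`, `n = 2`). Read in the
global coordinate `z`, the chart-wise complex structure is `i` on the closed upper half-plane and
`-i` below, so that type projections swap `(p,q) ↔ (q,p)` across the real axis. One computes
(all intermediate forms vanish to second order on the axis, so no junk value of `mextDeriv`
intervenes except where stated): `∂̄*α = ∂*α = -y` (smooth), hence
`∂̄∂̄*α (1) = (-dy)^{0,1} = -(i/2) dz̄` and `∂∂*α (1) = (-dy)^{1,0} = (i/2) dz`; while
`∂̄α = i|y| dx ∧ dy` and `∂α = -i|y| dx ∧ dy`, whose Hodge stars `± i|y|` are not differentiable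
on the axis, so that `∂⋆∂̄α (1)` and `∂̄⋆∂α (1)` are Mathlib's junk value `0` and
`∂̄*∂̄α (1) = ∂*∂α (1) = 0`. Thus `Δ_∂̄ α (1) = -(i/2) dz̄ ≠ (i/2) dz = Δ_∂ α (1)`. (Equivalently:
`Δ_∂ α = \overline{Δ_∂̄ ᾱ}` holds unconditionally — `dolbeaultLaplacian_conj` of
`KaehlerHodgeConjProofs.lean` — so the mis-stated family asserts that `Δ_∂̄` commutes with
conjugation, which fails at the chart seam.)

This file records, following the precedent of `Kaehler.lean` and `KaehlerHodgeComplexAtlasFact.lean`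
(a mis-stated named fact is corrected under a new name, never edited in place):

* `dolbeaultLaplacian_eq_delLaplacian_of_isManifold_complex g o` — the **corrected statement**,
  with the holomorphic atlas `[IsManifold 𝓘(ℂ, E) ω M]` an instance binder *of the `def`* and the
  body verbatim that of the old fact (same citation);
* `dolbeaultLaplacian_eq_delLaplacian_of_isManifold_complex_iff` — at a complex manifold the
  corrected `Prop` is definitionally the old one, so a future discharge serves the consumers of
  either (e.g. `dolbeaultHarmonicForms_conj_of_dolbeaultLaplacian_eq_delLaplacian` of
  `KaehlerHodgeConjProofs.lean`);
* `dolbeaultLaplacian_eq_delLaplacian_of_isManifold_complex_of_kaehlerIdentities` — the corrected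
  fact follows from the first-order Kähler identities `KaehlerIdentities o Λ`
  (`[Λ, ∂̄] = -i∂*`, `[Λ, ∂] = i∂̄*`, Voisin (2002), Prop. 6.5) for some contraction family `Λ`
  of the metric `g`, by the algebraic step proved in `KaehlerHodgeLaplacianProofs.lean`
  (Huybrechts (2005), Prop. 3.1.12, (ii) ⇒ (iii)).

What remains for a discharge `…_of_isManifold_complex_holds` is exactly Voisin's Prop. 6.5 for the
adjoint `Λ = ⋆⁻¹L⋆` of the Lefschetz operator `L = ω ∧ ·` of a Kähler metric (pointwise
Lefschetz/contraction operators on `Λ^k T*M ⊗ ℂ`, the flat identity Lemma 6.6, and osculating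
holomorphic coordinates Prop. 3.14 — or Huybrechts' route through the Lefschetz decomposition of
forms, Prop. 1.2.30–1.2.31), none of which is in the tree yet. The old `def` is untouched.

## References

* C. Voisin, *Hodge Theory and Complex Algebraic Geometry I* (2002), §3.1.3 Prop. 3.14, §6.1.1
  Prop. 6.5, Lemma 6.6 (pp. 139–140), §6.1.2 Thm. 6.7 (p. 141).
* D. Huybrechts, *Complex Geometry. An Introduction* (2005), §3.1, Prop. 3.1.12 (pp. 120–122).
* P. Griffiths, J. Harris, *Principles of Algebraic Geometry* (1978), pp. 111–115.
-/

noncomputable section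

open scoped Manifold ContDiff
open Bundle Module

namespace Literature.NumberTheory.Transcendental

open Literature.Geometry.Kaehler (MForm IsSmoothForm)

variable {E : Type*} [NormedAddCommGroup E] [NormedSpace ℂ E]
  {M : Type*} [TopologicalSpace M] [ChartedSpace E M] {k m : ℕ}
  [FiniteDimensional ℂ E] {n : ℕ} [Fact (finrank ℝ E = n)] [IsManifold 𝓘(ℝ, E) ∞ M]
  (g : ContMDiffRiemannianMetric 𝓘(ℝ, E) ∞ E (fun x : M ↦ TangentSpace 𝓘(ℝ, E) x))
  (o : (x : M) → Orientation ℝ (TangentSpace 𝓘(ℝ, E) x) (Fin n))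

/-- **Kähler identity `Δ_∂̄ = Δ_∂` — corrected statement** of
`Literature.NumberTheory.Transcendental.dolbeaultLaplacian_eq_delLaplacian` (same citation). Let
`M` be a **complex** manifold (holomorphic atlas: the instance `[IsManifold 𝓘(ℂ, E) ω M]` is a
binder *of this `def`*, so that the `Prop` is only stated for complex manifolds), `g` a smooth
Riemannian metric on its real tangent bundle which is Kähler (`hg`: Hermitian with closed Kähler
form), `o` an orientation family with smooth volume form (`ho`; the Laplacians do not depend on
`o`). Then for every smooth complex `k`-form `α` (`h : k + m = n = dim_ℝ M`), `Δ_∂̄ α = Δ_∂ α`,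
where `Δ_∂̄ = ∂̄∂̄* + ∂̄*∂̄` (`dolbeaultLaplacian`, `∂̄* = -⋆∂⋆`) and `Δ_∂ = ∂∂* + ∂*∂`
(`delLaplacian`, `∂* = -⋆∂̄⋆`) for the `ℂ`-linear Hodge star of `g`. A local identity (no
compactness). Voisin (2002), §6.1.2, Thm. 6.7 (p. 141: "Let `(X, ω)` be a Kähler manifold …
`Δ_∂ = Δ_∂̄ = ½Δ_d`", proof from Prop. 6.5); Huybrechts (2005), Prop. 3.1.12 (iii) ("Let `X` be
a complex manifold endowed with a Kähler metric `g` … `Δ_∂ = Δ_∂̄ = ½Δ`"); Griffiths–Harris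
(1978), p. 115. The body is verbatim that of the old fact, which lacks the complex-manifold binder
and is false over general real atlases (module docstring). Not proved here: the first-order Kähler
identities it reduces to (`…_of_kaehlerIdentities`) are not yet in the tree. [cite: Voisin2002, §6.1.2 Thm. 6.7] -/
def dolbeaultLaplacian_eq_delLaplacian_of_isManifold_complex [IsManifold 𝓘(ℂ, E) ω M] : Prop :=
  ∀ (hg : g.toRiemannianMetric.IsKaehler) (h : k + m = n) {α : MForm 𝓘(ℝ, E) M ℂ k}
    (hα : IsSmoothForm α),
    letI : RiemannianBundle (fun x : M ↦ TangentSpace 𝓘(ℝ, E) x) := ⟨g.toRiemannianMetric⟩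
    IsSmoothForm (Literature.Geometry.Kaehler.riemannianVolumeForm o) →
      dolbeaultLaplacian o k m h α = delLaplacian o k m h α

/-- At a complex manifold the corrected fact *is* the old `Prop`
`dolbeaultLaplacian_eq_delLaplacian g o` (identical bodies), so a future discharge of the
corrected fact serves every consumer written against the old name. [folklore] -/
theorem dolbeaultLaplacian_eq_delLaplacian_of_isManifold_complex_iff [IsManifold 𝓘(ℂ, E) ω M] :
    dolbeaultLaplacian_eq_delLaplacian_of_isManifold_complex (k := k) (m := m) g o ↔
      dolbeaultLaplacian_eq_delLaplacian (k := k) (m := m) g o :=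
  Iff.rfl

/-- **The corrected fact from the first-order Kähler identities.** On a complex manifold with a
smooth metric `g`, if some contraction family `Λ` satisfies `KaehlerIdentities o Λ` for the
metric `g` (`[Λ, ∂̄] = -i∂*`, `[Λ, ∂] = i∂̄*`: Voisin (2002), Prop. 6.5, for `Λ = ⋆⁻¹L⋆` when
`g` is Kähler), then `dolbeaultLaplacian_eq_delLaplacian_of_isManifold_complex g o` holds — the
algebraic step Huybrechts (2005), Prop. 3.1.12 (ii) ⇒ (iii), via
`dolbeaultLaplacian_eq_delLaplacian_of_kaehlerIdentities`. [cite: Huybrechts2005, Prop. 3.1.12 (iii)] -/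
theorem dolbeaultLaplacian_eq_delLaplacian_of_isManifold_complex_of_kaehlerIdentities
    [IsManifold 𝓘(ℂ, E) ω M] {Λ : (j : ℕ) → MForm 𝓘(ℝ, E) M ℂ (j + 2) → MForm 𝓘(ℝ, E) M ℂ j}
    (hΛ : letI : RiemannianBundle (fun x : M ↦ TangentSpace 𝓘(ℝ, E) x) := ⟨g.toRiemannianMetric⟩
      KaehlerIdentities o Λ) :
    dolbeaultLaplacian_eq_delLaplacian_of_isManifold_complex (k := k) (m := m) g o :=
  dolbeaultLaplacian_eq_delLaplacian_of_kaehlerIdentities g o hΛ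

end Literature.NumberTheory.Transcendental
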